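/-
Copyright (c) 2026 the pub-hodgecm-mathlib formalisation cell (harness21).  Prover seat hodgecm-mathlib-K2E4-p13 (g3), Track B «K2-LIT» ∕ h413
(`stmt-HodgeConjecture-24833`), line `K2_E3_EllipticInputs`, unit U12 (SC-an), road «FC», brick (FC-H) «STRONG HENSEL» — currency twins.  2026-09-04.
-/
import Summits.HodgeConjecture.HodgeConjecture.Theorems.K2E3StrongHensel   -- ★ p857175 (K2E5-p01 g4): `exists_isRoot_add_mul_of_eval_eq_sq_mul` (strong Hensel, ideal form)
import HarnessLib

/-!
# K2_E3 road (h413), (SC-an) road «FC», brick (FC-H) — strong Hensel in the `valuation K` and `Valued.v` currencies, at the level of `K`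

Cell `pub/hodgecm-mathlib` (D-0151), Track B, seat K2E4-p13 (g3) (free E4 hand on the E3 (SC-an) line; line lead K2E3-p14 (g4) RULINGS #16 (R16-4),
dealer K2E3-plan (g3)).  `--supports stmt-HodgeConjecture-24833 --as helper`; THEOREMS ONLY (no definition ∕ instance ∕ notation ∕ named fact ∕ `sorry`);
never imports `Cruxes/…/Lines`.  COUNT-NEUTRAL.  Companion of ★ `Theorems/K2E3StrongHensel` (K2E5-p01 (g4), p857175), which proves strong Hensel in
the ideal-theoretic form (`exists_isRoot_add_mul_of_eval_eq_sq_mul`: a root `a₀ + f′(a₀) t` with `t R = ε R`) and in the `normAbs` currency on `𝒪[K]`.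
This file re-expresses it, WITHOUT restating anything, in the two currencies the (FC-6a)∕(FC-6b) consumers compute in:
* §1 `exists_isRoot_of_valuation_eval_lt_sq` — `𝒪[K]`, currency `valuation K` (the valuation of the valuative relation), with the SHARP EQUALITY
  `v(a − a₀) · v(f′(a₀)) = v(f(a₀))` (from `t R = ε R`), hence `v(a − a₀) < v(f′(a₀))` (`valuation_sub_lt_of_mul_eq`);
* §2 `exists_isRoot_of_valuation_eval_lt_sq_of_forall_coeff` — the same AT THE LEVEL OF `K`: `p ∈ K[X]` with every coefficient of valuation `≤ 1`,
  `v(a₀) ≤ 1`, `v(p(a₀)) < v(p′(a₀))²` ⇒ a root `a ∈ K`, `v(a) ≤ 1`, `v(a − a₀) · v(p′(a₀)) = v(p(a₀))`, `v(a − a₀) < v(p′(a₀))` (no element of `𝒪[K]`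
  has to be built by the consumer; `Polynomial.toSubring` inside);
* §3 `exists_isRoot_of_v_eval_lt_sq_of_forall_coeff` — the `Valued.v` ∕ `ℤᵐ⁰` twin of §2 in the frame
  `[Field K] [Valued K ℤᵐ⁰] [ValuativeRel K] [(Valued.v).Compatible] [IsNonarchimedeanLocalField K]` of ★ `K2E3WittCartan` ∕ (FC-6a)
  `K2E3NearTriangularEigenvalues` (transport along `Valuation.Compatible`: both valuations induce `≤ᵥ`).
[Cassels1986, Ch. 4 §3 Lemma 3.1 («Hensel's Lemma»: `|f(a₀)| < |f′(a₀)|²` ⇒ a root `a`) with Cor. 1 (3.10) `|a − a₀| ≤ |f(a₀)|∕|f′(a₀)|`, pp. 49–50]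
[LangANT1994, Ch. II §2 Prop. 2 (Newton approximation under `|f(α₀)| < |f′(α₀)²|`)] [NeukirchANT1999, Ch. II §4 Lemma (4.6) (Hensel)]
HONEST LABEL: HC_CM is proved only modulo the 7 printed citations (2 remaining named inputs: hLiu418 = stmt-HodgeConjecture-24832, h413 =
stmt-HodgeConjecture-24833) until rung 0 closes; count-neutral helper toward the (SC-an) road «FC»; no socket closes.

## References
* [Cassels1986] J. W. S. Cassels, *Local Fields*, LMS Student Texts 3 (1986), Ch. 4 §3 Lemma 3.1 and Corollary 1, pp. 49–50.
* [LangANT1994] S. Lang, *Algebraic Number Theory*, 2nd ed., GTM 110 (1994), Ch. II §2 Prop. 2.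
* [NeukirchANT1999] J. Neukirch, *Algebraic Number Theory* (1999), Ch. II §4 Lemma (4.6) (Hensel's lemma).
-/

set_option autoImplicit false
set_option linter.dupNamespace false   -- `Summit.HodgeConjecture.HodgeConjecture.…` (D-0017 nested layout; lakefile exemption for Summits)

noncomputable section

open Polynomial
open Summit.HodgeConjecture.HodgeConjecture.Cruxes.H413.K2E3StrongHensel

namespace Summit.HodgeConjecture.HodgeConjecture.Cruxes.H413.K2E3StrongHenselValued

/-! ## §1  `𝒪[K]`, currency `valuation K`: `v(f(a₀)) < v(f′(a₀))²` ⇒ a root `a` with `v(a − a₀) · v(f′(a₀)) = v(f(a₀))` -/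

section LocalField

open ValuativeRel

variable {K : Type*} [Field K] [ValuativeRel K] [TopologicalSpace K] [IsNonarchimedeanLocalField K]

omit [TopologicalSpace K] [IsNonarchimedeanLocalField K] in
/-- From `v(a − a₀) · v(b) = v(e)` and `v(e) < v(b)²`: `v(a − a₀) < v(b)` (a root this close to `a₀` is strictly `v(f′(a₀))`-close).
[cite: Cassels1986, Ch. 4 §3 Lemma 3.1 and Cor. 1 pp. 49–50] -/
theorem valuation_sub_lt_of_mul_eq {a a₀ b e : K} (h : valuation K e < valuation K b ^ 2)
    (hab : valuation K (a - a₀) * valuation K b = valuation K e) : valuation K (a - a₀) < valuation K b := by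
  by_contra hle
  rw [not_lt] at hle
  have h' : valuation K b ^ 2 ≤ valuation K e := by
    rw [pow_two, ← hab]
    exact mul_le_mul_left hle _
  exact (lt_irrefl _) (h.trans_le h')

/-- **Strong Hensel over the valuation ring of a non-archimedean local field, `valuation K` currency, sharp form**: for `f ∈ 𝒪[K][X]` (any degree)
and `a₀ ∈ 𝒪[K]` with `v(f(a₀)) < v(f′(a₀))²` there is a root `a ∈ 𝒪[K]` of `f` with `v(a − a₀) · v(f′(a₀)) = v(f(a₀))`, i.e.
`|a − a₀| = |f(a₀)∕f′(a₀)|`.  From ★ `exists_isRoot_add_mul_of_eval_eq_sq_mul` with `I = 𝓂[K]` (`𝒪[K]` is `𝓂`-adically complete, Mathlib) and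
`ε = f(a₀)∕f′(a₀)²`: the root is `a₀ + f′(a₀) t` with `t 𝒪 = ε 𝒪`, so `v(t) = v(ε)`.
[cite: Cassels1986, Ch. 4 §3 Lemma 3.1 and Cor. 1 pp. 49–50] [cite: LangANT1994, Ch. II §2 Prop. 2] [cite: NeukirchANT1999, Ch. II §4 Lemma (4.6)] -/
theorem exists_isRoot_of_valuation_eval_lt_sq (f : Polynomial 𝒪[K]) (a₀ : 𝒪[K])
    (h : valuation K (↑(f.eval a₀) : K) < valuation K (↑(f.derivative.eval a₀) : K) ^ 2) :
    ∃ a : 𝒪[K], f.IsRoot a ∧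
      valuation K ((a : K) - a₀) * valuation K (↑(f.derivative.eval a₀) : K) = valuation K (↑(f.eval a₀) : K) := by
  letI : UniformSpace K := IsTopologicalAddGroup.rightUniformSpace K
  haveI : IsUniformAddGroup K := isUniformAddGroup_of_addCommGroup
  set b : 𝒪[K] := f.derivative.eval a₀ with hb
  -- `b ≠ 0`
  have hb0 : (b : K) ≠ 0 := by
    intro h0
    rw [h0, map_zero, zero_pow two_ne_zero] at h
    exact not_lt_zero h
  have hvb : valuation K (b : K) ≠ 0 := (_root_.map_ne_zero _).2 hb0
  -- `ε = f(a₀) ∕ b²` lies in `𝓂[K]`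
  have hεv : valuation K ((↑(f.eval a₀) : K) / (b : K) ^ 2) < 1 := by
    rw [map_div₀, map_pow, div_lt_one₀ (pos_iff_ne_zero.2 (pow_ne_zero 2 hvb))]
    exact h
  have hεO : (↑(f.eval a₀) : K) / (b : K) ^ 2 ∈ 𝒪[K] := (Valuation.mem_integer_iff _ _).2 hεv.le
  set ε : 𝒪[K] := ⟨(↑(f.eval a₀) : K) / (b : K) ^ 2, hεO⟩ with hε
  have hεm : ε ∈ 𝓂[K] := by
    rw [IsLocalRing.mem_maximalIdeal, mem_nonunits_iff, Valuation.Integer.not_isUnit_iff_valuation_lt_one]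
    exact hεv
  have h2 : (b : K) ^ 2 * (ε : K) = (↑(f.eval a₀) : K) := by
    rw [hε]
    change (b : K) ^ 2 * ((↑(f.eval a₀) : K) / (b : K) ^ 2) = (↑(f.eval a₀) : K)
    rw [mul_div_cancel₀ _ (pow_ne_zero 2 hb0)]
  have hfe : f.eval a₀ = f.derivative.eval a₀ ^ 2 * ε := by
    apply Subtype.ext
    rw [← hb]
    push_cast
    exact h2.symm
  obtain ⟨t, hroot, htε, hεt⟩ := exists_isRoot_add_mul_of_eval_eq_sq_mul 𝓂[K] f a₀ ε hεm hfe
  refine ⟨a₀ + f.derivative.eval a₀ * t, hroot, ?_⟩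
  -- `t 𝒪 = ε 𝒪` ⇒ `v(t) = v(ε)`
  have hvt : valuation K (t : K) = valuation K (ε : K) := by
    obtain ⟨r, hr⟩ := Ideal.mem_span_singleton'.1 htε
    obtain ⟨r', hr'⟩ := Ideal.mem_span_singleton'.1 hεt
    apply le_antisymm
    · have : (t : K) = (r : K) * (ε : K) := by rw [← hr]; push_cast; ring
      rw [this, map_mul]
      exact mul_le_of_le_one_left zero_le ((Valuation.mem_integer_iff _ _).1 r.2)
    · have : (ε : K) = (r' : K) * (t : K) := by rw [← hr']; push_cast; ring
      rw [this, map_mul]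
      exact mul_le_of_le_one_left zero_le ((Valuation.mem_integer_iff _ _).1 r'.2)
  -- `(a − a₀) · b = b² t` and `v(b² t) = v(b² ε) = v(f(a₀))`
  have hprod : (((a₀ + f.derivative.eval a₀ * t : 𝒪[K]) : K) - a₀) * (b : K) = (b : K) ^ 2 * (t : K) := by
    rw [← hb]
    push_cast
    ring
  rw [← map_mul, hprod, map_mul, hvt, ← map_mul, h2]

/-- The inequality form asked for by (R16-4): a root `a ∈ 𝒪[K]` with `v(a − a₀) · v(f′(a₀)) ≤ v(f(a₀))` (`valuation K` currency).
[cite: Cassels1986, Ch. 4 §3 Lemma 3.1 and Cor. 1 pp. 49–50] -/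
theorem exists_isRoot_of_valuation_eval_lt_sq_le (f : Polynomial 𝒪[K]) (a₀ : 𝒪[K])
    (h : valuation K (↑(f.eval a₀) : K) < valuation K (↑(f.derivative.eval a₀) : K) ^ 2) :
    ∃ a : 𝒪[K], f.IsRoot a ∧
      valuation K ((a : K) - a₀) * valuation K (↑(f.derivative.eval a₀) : K) ≤ valuation K (↑(f.eval a₀) : K) := by
  obtain ⟨a, ha, hv⟩ := exists_isRoot_of_valuation_eval_lt_sq f a₀ h
  exact ⟨a, ha, hv.le⟩

/-! ## §2  At the level of `K`: a polynomial with integral coefficients -/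

/-- **Strong Hensel over `K` for a polynomial with integral coefficients** (`v` = the valuation of the valuative relation): if every coefficient
of `p ∈ K[X]` has `v ≤ 1`, `v(a₀) ≤ 1` and `v(p(a₀)) < v(p′(a₀))²`, then `p` has a root `a ∈ K` with `v(a) ≤ 1`,
`v(a − a₀) · v(p′(a₀)) = v(p(a₀))` and `v(a − a₀) < v(p′(a₀))` (lift `p` to `𝒪[K][X]` with `Polynomial.toSubring` and apply §1).
[cite: Cassels1986, Ch. 4 §3 Lemma 3.1 and Cor. 1 pp. 49–50] [cite: LangANT1994, Ch. II §2 Prop. 2] -/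
theorem exists_isRoot_of_valuation_eval_lt_sq_of_forall_coeff (p : K[X]) (hp : ∀ n, valuation K (p.coeff n) ≤ 1) {a₀ : K}
    (ha₀ : valuation K a₀ ≤ 1) (h : valuation K (p.eval a₀) < valuation K (p.derivative.eval a₀) ^ 2) :
    ∃ a : K, p.IsRoot a ∧ valuation K a ≤ 1 ∧
      valuation K (a - a₀) * valuation K (p.derivative.eval a₀) = valuation K (p.eval a₀) ∧
      valuation K (a - a₀) < valuation K (p.derivative.eval a₀) := by
  -- lift `p` to `𝒪[K][X]`
  have hsub : (↑p.coeffs : Set K) ⊆ ((𝒪[K] : Subring K) : Set K) := by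
    intro x hx
    obtain ⟨n, -, rfl⟩ := mem_coeffs_iff.1 (Finset.mem_coe.1 hx)
    exact (Valuation.mem_integer_iff _ _).2 (hp n)
  set f : Polynomial 𝒪[K] := p.toSubring 𝒪[K] hsub with hf
  have hmap : f.map (Subring.subtype 𝒪[K]) = p := map_toSubring _ _ _
  set b₀ : 𝒪[K] := ⟨a₀, (Valuation.mem_integer_iff _ _).2 ha₀⟩ with hb₀
  have hev : ∀ x : 𝒪[K], p.eval (x : K) = (↑(f.eval x) : K) := by
    intro x
    conv_lhs => rw [← hmap, eval_map]
    exact eval₂_hom (Subring.subtype 𝒪[K]) x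
  have hev' : ∀ x : 𝒪[K], p.derivative.eval (x : K) = (↑(f.derivative.eval x) : K) := by
    intro x
    conv_lhs => rw [← hmap, derivative_map, eval_map]
    exact eval₂_hom (Subring.subtype 𝒪[K]) x
  have h0 : p.eval a₀ = (↑(f.eval b₀) : K) := hev b₀
  have h1 : p.derivative.eval a₀ = (↑(f.derivative.eval b₀) : K) := hev' b₀
  rw [h0, h1] at h
  obtain ⟨a, ha, hva⟩ := exists_isRoot_of_valuation_eval_lt_sq f b₀ h
  refine ⟨a, ?_, (Valuation.mem_integer_iff _ _).1 a.2, ?_, ?_⟩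
  · change p.eval (a : K) = 0
    rw [hev a, ha.eq_zero]
    rfl
  · rw [h0, h1]; exact hva
  · rw [h1]
    exact valuation_sub_lt_of_mul_eq h hva

end LocalField

/-! ## §3  The `Valued.v` currency (compatible `ℤᵐ⁰`-valued valuation, the frame of ★ `K2E3WittCartan` ∕ (FC-6a)) -/

section ValuedCurrency

open ValuativeRel
open scoped WithZero

variable {K : Type*} [Field K] [Valued K ℤᵐ⁰] [ValuativeRel K] [(Valued.v : Valuation K ℤᵐ⁰).Compatible] [IsNonarchimedeanLocalField K]

/-- **Strong Hensel over `K`, `Valued.v` currency**: for `p ∈ K[X]` with `|coeff| ≤ 1`, `|a₀| ≤ 1` and `|p(a₀)| < |p′(a₀)|²` (all in the compatible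
`ℤᵐ⁰`-valued `Valued.v`), there is a root `a ∈ K` with `|a| ≤ 1`, `|a − a₀| · |p′(a₀)| = |p(a₀)|` and `|a − a₀| < |p′(a₀)|` — §2 transported along
`Valuation.Compatible` (both `Valued.v` and `valuation K` induce the valuative relation `≤ᵥ`).
[cite: Cassels1986, Ch. 4 §3 Lemma 3.1 and Cor. 1 pp. 49–50] [cite: LangANT1994, Ch. II §2 Prop. 2] -/
theorem exists_isRoot_of_v_eval_lt_sq_of_forall_coeff (p : K[X]) (hp : ∀ n, Valued.v (p.coeff n) ≤ 1) {a₀ : K}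
    (ha₀ : Valued.v a₀ ≤ 1) (h : Valued.v (p.eval a₀) < Valued.v (p.derivative.eval a₀) ^ 2) :
    ∃ a : K, p.IsRoot a ∧ Valued.v a ≤ 1 ∧
      Valued.v (a - a₀) * Valued.v (p.derivative.eval a₀) = Valued.v (p.eval a₀) ∧
      Valued.v (a - a₀) < Valued.v (p.derivative.eval a₀) := by
  -- the dictionary between the two valuations
  have hle : ∀ x y : K, Valued.v x ≤ Valued.v y ↔ valuation K x ≤ valuation K y := fun x y => by
    rw [← Valuation.vle_iff_le (Valued.v : Valuation K ℤᵐ⁰), Valuation.vle_iff_le (valuation K)]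
  have hlt : ∀ x y : K, Valued.v x < Valued.v y ↔ valuation K x < valuation K y := fun x y => by
    rw [← Valuation.vlt_iff_lt (Valued.v : Valuation K ℤᵐ⁰), Valuation.vlt_iff_lt (valuation K)]
  have heq : ∀ x y : K, Valued.v x = Valued.v y ↔ valuation K x = valuation K y := fun x y => by
    rw [le_antisymm_iff, le_antisymm_iff, hle, hle]
  have hle1 : ∀ x : K, Valued.v x ≤ 1 ↔ valuation K x ≤ 1 := fun x => by
    rw [← (Valued.v : Valuation K ℤᵐ⁰).map_one, hle, map_one]
  have hp' : ∀ n, valuation K (p.coeff n) ≤ 1 := fun n => (hle1 _).1 (hp n)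
  have ha₀' : valuation K a₀ ≤ 1 := (hle1 _).1 ha₀
  have h' : valuation K (p.eval a₀) < valuation K (p.derivative.eval a₀) ^ 2 := by
    rw [← map_pow, ← hlt, map_pow]; exact h
  obtain ⟨a, ha, ha1, hva, hlt'⟩ := exists_isRoot_of_valuation_eval_lt_sq_of_forall_coeff p hp' ha₀' h'
  refine ⟨a, ha, (hle1 _).2 ha1, ?_, (hlt _ _).2 hlt'⟩
  rw [← map_mul, heq, map_mul]
  exact hva

end ValuedCurrency

end Summit.HodgeConjecture.HodgeConjecture.Cruxes.H413.K2E3StrongHenselValued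

end
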